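import Summits.Schanuel.Schanuel.Theorems.ZilberEacWeightedPlaces
import Mathlib.FieldTheory.IntermediateField.Adjoin.Basic
import Mathlib.RingTheory.Algebraic.Integral
import HarnessLib

/-!
# Arbitrary base branches, LXXXI: the leading coefficient of a place of a curve with ALGEBRAIC
# coefficients is ALGEBRAIC (the top-weight equation)

HONEST FRAMING.  Cell `pub-schanuel` (Zilber's Exponential-Algebraic Closedness, case ladder;
host summit Schanuel), seat 2, gen 32.  Step E4 of the roadmap "every curve over `ℚ̄`": if
`G ∈ ℂ[x₀][x₁]` is nonzero with all coefficients algebraic over `ℚ` and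
`G(s^{-k}, γ(s)s^{-M}) = 0` on a punctured neighbourhood of `s = 0` (`k ≥ 1`, `γ` continuous at
`0`), then `γ(0)` is algebraic over `ℚ`: multiplying by `s^D`, `D = max{ki + Mj : g_{ij} ≠ 0}`, and
letting `s → 0` leaves `Σ_{ki+Mj=D} g_{ij} γ(0)^j = 0`, a NONZERO polynomial in `γ(0)` (distinct `j`
on the top line) with algebraic coefficients (**`isAlgebraic_leadCoeff_of_place`**).  It applies
to the direction `Φ(0)` of a place AND to the leading coefficient `γ(0)` of a sheared coordinate
(a place of the transported curve), which is what makes resonance impossible over `ℚ̄`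
(Lindemann; next file).  [folklore]; nothing here is specific to Schanuel's conjecture (neither used
nor implied); Mantova–Masser's question and EC(3,2) stay OPEN.
-/

noncomputable section

open Filter Topology Polynomial

set_option linter.dupNamespace false

namespace Summit.Schanuel.Schanuel.Theorems

/-- **Roots of a nonzero polynomial with algebraic coefficients are algebraic** (over `ℚ`, in `ℂ`).
[folklore] -/
theorem isAlgebraic_of_root_of_coeff_isAlgebraic {P : ℂ[X]} (hP0 : P ≠ 0)
    (halg : ∀ n, IsAlgebraic ℚ (P.coeff n)) {x : ℂ} (hx : P.eval x = 0) : IsAlgebraic ℚ x := by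
  classical
set S : Set ℂ := ↑((Finset.range (P.natDegree + 1)).image fun n => P.coeff n) with hS
  set E := IntermediateField.adjoin ℚ S with hE
  have hSint : ∀ y ∈ S, IsIntegral ℚ y := by
    intro y hy
    rw [hS, Finset.coe_image] at hy
    obtain ⟨n, -, rfl⟩ := hy
    exact (halg n).isIntegral
  haveI : Algebra.IsAlgebraic ℚ E := IntermediateField.isAlgebraic_adjoin hSint
  -- `P` lifts to `E[X]`
  have hlift : P ∈ Polynomial.lifts (algebraMap E ℂ) := by
    rw [Polynomial.lifts_iff_coeff_lifts]
    intro n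
    by_cases hn : n ≤ P.natDegree
    · have hmem : P.coeff n ∈ E := by
        apply IntermediateField.subset_adjoin
        rw [hS, Finset.coe_image]
        exact ⟨n, by simp; omega, rfl⟩
      exact ⟨⟨P.coeff n, hmem⟩, rfl⟩
    · refine ⟨0, ?_⟩
      rw [map_zero, Polynomial.coeff_eq_zero_of_natDegree_lt (by omega)]
  obtain ⟨q, hq⟩ := (Polynomial.mem_lifts _).1 hlift
  have hq0 : q ≠ 0 := by
    rintro rfl
    rw [Polynomial.map_zero] at hq
    exact hP0 hq.symm
  have halgE : IsAlgebraic E x := by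
    refine ⟨q, hq0, ?_⟩
    rw [Polynomial.aeval_def, ← Polynomial.eval_map, hq, hx]
  exact halgE.restrictScalars ℚ

/-- **The leading coefficient of a place of a curve with algebraic coefficients is algebraic.**
`G ≠ 0` with all `[x₀^i x₁^j]G` algebraic over `ℚ`; `k ≥ 1`; `γ` continuous at `0`;
`G(s^{-k}, γ(s)s^{-M}) = 0` for small `s ≠ 0` ⟹ `γ(0)` is algebraic over `ℚ`. [folklore] -/
theorem isAlgebraic_leadCoeff_of_place (G : ℂ[X][X]) (hG0 : G ≠ 0)
    (halg : ∀ i j, IsAlgebraic ℚ ((G.coeff j).coeff i)) {k : ℕ} (hk : 1 ≤ k) (M : ℕ)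
    {γ : ℂ → ℂ} (hγ : ContinuousAt γ 0)
    (hplace : ∀ᶠ s in 𝓝[≠] (0 : ℂ),
      (G.map (Polynomial.evalRingHom (s ^ k)⁻¹)).eval (γ s * (s ^ M)⁻¹) = 0) :
    IsAlgebraic ℚ (γ 0) := by
  classical
  -- indices, coefficients, weights
  set n := G.natDegree with hn
  set N := (Finset.range (n + 1)).sup fun j => (G.coeff j).natDegree with hN
  have hNj : ∀ j, (G.coeff j).natDegree ≤ N := by
    intro j
    by_cases hj : j ≤ n
    · exact Finset.le_sup (f := fun j => (G.coeff j).natDegree) (Finset.mem_range.2 (by omega))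
    · rw [Polynomial.coeff_eq_zero_of_natDegree_lt (by omega), Polynomial.natDegree_zero]
      exact Nat.zero_le _
  set g : ℕ × ℕ → ℂ := fun p => (G.coeff p.2).coeff p.1 with hg
  set w : ℕ × ℕ → ℕ := fun p => k * p.1 + M * p.2 with hw
  set Idx : Finset (ℕ × ℕ) := Finset.range (N + 1) ×ˢ Finset.range (n + 1) with hIdx
  set Sp : Finset (ℕ × ℕ) := Idx.filter fun p => g p ≠ 0 with hSp
  -- the support is nonempty
  have hSpne : Sp.Nonempty := by
    have h1 : G.coeff n ≠ 0 := Polynomial.leadingCoeff_ne_zero.2 hG0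
    have h2 : (G.coeff n).coeff (G.coeff n).natDegree ≠ 0 := Polynomial.leadingCoeff_ne_zero.2 h1
    refine ⟨((G.coeff n).natDegree, n), ?_⟩
    rw [hSp, Finset.mem_filter, hIdx, Finset.mem_product, Finset.mem_range, Finset.mem_range]
    exact ⟨⟨by have := hNj n; omega, by omega⟩, h2⟩
  set D : ℕ := Sp.sup w with hD
  have hwD : ∀ p ∈ Sp, w p ≤ D := fun p hp => Finset.le_sup hp
  obtain ⟨p₀, hp₀, hp₀D0⟩ := Finset.exists_mem_eq_sup Sp hSpne w
  have hp₀D : D = w p₀ := by rw [hD]; exact hp₀D0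
  -- the evaluation as a double sum
  have heval : ∀ x y : ℂ, (G.map (Polynomial.evalRingHom x)).eval y =
      ∑ p ∈ Idx, g p * x ^ p.1 * y ^ p.2 := by
    intro x y
    rw [Polynomial.eval_map, Polynomial.eval₂_eq_sum_range, hIdx, Finset.sum_product_right]
    refine Finset.sum_congr rfl fun j _ => ?_
    rw [Polynomial.coe_evalRingHom, Polynomial.eval_eq_sum_range' (n := N + 1)
      (by have := hNj j; omega), Finset.sum_mul]
  -- `Q(s) = Σ g γ(s)^j s^{D − w}` vanishes near `0`, hence at `0`
  set Q : ℂ → ℂ := fun s => ∑ p ∈ Sp, g p * γ s ^ p.2 * s ^ (D - w p) with hQ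
  have hQeq : ∀ᶠ s in 𝓝[≠] (0 : ℂ), Q s = 0 := by
    filter_upwards [hplace, self_mem_nhdsWithin] with s hs (hs0 : s ≠ 0)
    have h1 : s ^ D * (G.map (Polynomial.evalRingHom (s ^ k)⁻¹)).eval (γ s * (s ^ M)⁻¹) = 0 := by
      rw [hs, mul_zero]
    rw [heval, Finset.mul_sum] at h1
    rw [hQ]
    simp only
    rw [← h1, hSp, Finset.sum_filter]
    refine Finset.sum_congr rfl fun p _ => ?_
    split_ifs with hgp
    · have hpS : p ∈ Sp := by
        rw [hSp, Finset.mem_filter]; exact ⟨‹p ∈ Idx›, hgp⟩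
      have hle := hwD p hpS
      rw [pow_sub₀ s hs0 hle, hw]
      simp only
      rw [mul_pow, inv_pow, inv_pow, ← pow_mul, ← pow_mul, pow_add, mul_inv]
      ring
    · push Not at hgp
      simp [hgp]
  have hQt : Tendsto Q (𝓝 0) (𝓝 (Q 0)) := by
    simp only [hQ]
    refine tendsto_finsetSum _ fun p _ => ?_
    exact (tendsto_const_nhds.mul (hγ.tendsto.pow _)).mul ((continuous_id.tendsto 0).pow _)
  have hQ0 : Q 0 = 0 := by
    have h1 : Tendsto Q (𝓝[≠] (0 : ℂ)) (𝓝 (Q 0)) := hQt.mono_left nhdsWithin_le_nhds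
    have h2 : Tendsto Q (𝓝[≠] (0 : ℂ)) (𝓝 0) :=
      (tendsto_const_nhds (x := (0 : ℂ))).congr' (hQeq.mono fun s hs => hs.symm)
    exact tendsto_nhds_unique h1 h2
  -- the top-weight polynomial `P`
  set Top : Finset (ℕ × ℕ) := Sp.filter fun p => w p = D with hTop
  set P : ℂ[X] := ∑ p ∈ Top, Polynomial.C (g p) * X ^ p.2 with hP
  have hQ0' : ∑ p ∈ Sp, g p * γ 0 ^ p.2 * (0 : ℂ) ^ (D - w p) = 0 := by
    have h := hQ0
    simp only [hQ] at h
    exact h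
  have hPeval : P.eval (γ 0) = 0 := by
    refine Eq.trans ?_ hQ0'
    rw [hP, Polynomial.eval_finsetSum, hTop, Finset.sum_filter]
    refine Finset.sum_congr rfl fun p hp => ?_
    split_ifs with hpD
    · rw [Polynomial.eval_mul, Polynomial.eval_C, Polynomial.eval_pow, Polynomial.eval_X, hpD,
        Nat.sub_self, pow_zero, mul_one]
    · have hlt : 0 < D - w p := by have := hwD p hp; omega
      rw [zero_pow hlt.ne', mul_zero]
  -- `P ≠ 0`: the `X^{j₀}` coefficient is `g p₀` (distinct `j` on the top line)
  have huniq : ∀ p ∈ Top, p.2 = p₀.2 → p = p₀ := by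
    intro p hp hj
    rw [hTop, Finset.mem_filter] at hp
    have h1 : w p = w p₀ := by rw [hp.2, hp₀D]
    simp only [hw, hj] at h1
    have h2 : p.1 = p₀.1 := by
      have : k * p.1 = k * p₀.1 := by omega
      exact Nat.eq_of_mul_eq_mul_left (by omega) this
    exact Prod.ext h2 hj
  have hPcoeff : P.coeff p₀.2 = g p₀ := by
    rw [hP, Polynomial.finsetSum_coeff]
    have hp₀T : p₀ ∈ Top := by rw [hTop, Finset.mem_filter]; exact ⟨hp₀, hp₀D.symm⟩
    rw [Finset.sum_eq_single p₀]
    · simp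
    · intro p hp hne
      rw [Polynomial.coeff_C_mul, Polynomial.coeff_X_pow]
      by_cases hj : p₀.2 = p.2
      · exact absurd (huniq p hp hj.symm) hne
      · rw [if_neg hj, mul_zero]
    · intro h; exact absurd hp₀T h
  have hg₀ : g p₀ ≠ 0 := by
    have := hp₀; rw [hSp, Finset.mem_filter] at this; exact this.2
  have hP0 : P ≠ 0 := fun h => hg₀ (by rw [← hPcoeff, h, Polynomial.coeff_zero])
  -- the coefficients of `P` are algebraic
  have hPalg : ∀ m, IsAlgebraic ℚ (P.coeff m) := by
    intro m
    rw [hP, Polynomial.finsetSum_coeff]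
    rw [isAlgebraic_iff_isIntegral]
    refine IsIntegral.sum _ fun p _ => ?_
    rw [Polynomial.coeff_C_mul, Polynomial.coeff_X_pow]
    split_ifs
    · rw [mul_one]; exact (halg p.1 p.2).isIntegral
    · rw [mul_zero]; exact isIntegral_zero
  exact isAlgebraic_of_root_of_coeff_isAlgebraic hP0 hPalg hPeval

end Summit.Schanuel.Schanuel.Theorems

end
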